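import Summits.RiemannHypothesis.RiemannHypothesis.Theorems.WeilGroundStateGroundStateSimpleEvenTrialUpperFConst
import Summits.RiemannHypothesis.RiemannHypothesis.Theorems.WeilTwoPrimeDeflC83XCertLev
import Summits.RiemannHypothesis.RiemannHypothesis.Theorems.WeilTwoPrimeDeflC83XCertB0
import Summits.RiemannHypothesis.RiemannHypothesis.Theorems.WeilTwoPrimeDeflC83XCertNu
import Summits.RiemannHypothesis.RiemannHypothesis.Theorems.WeilTwoPrimeDeflC83XDataR
import Summits.RiemannHypothesis.RiemannHypothesis.Theorems.WeilTwoPrimeDeflC83XKappa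
import Summits.RiemannHypothesis.RiemannHypothesis.Theorems.GroundBartaEvenWinsBeyondArchPhantomCertificateDeflatedEven
import Summits.RiemannHypothesis.RiemannHypothesis.Theorems.GroundBartaEvenWinsBeyondArchDeflationCertSectorSplit
import Literature.NumberTheory.LFunctions.WeilDeflationPenaltyPolyEval
import Summits.RiemannHypothesis.RiemannHypothesis.Theorems.GroundBartaEvenWinsBeyondArchDeflationCrossGram
import Summits.RiemannHypothesis.RiemannHypothesis.Theorems.GroundBartaEvenWinsBeyondArchDeflationCertBridgeWXA45
import Summits.RiemannHypothesis.RiemannHypothesis.Theorems.GroundBartaEvenWinsBeyondArchDeflationCertBridgeW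
import Summits.RiemannHypothesis.RiemannHypothesis.Theorems.GroundBartaEvenWinsBeyondArchDeflationWeightedCore
import Summits.RiemannHypothesis.RiemannHypothesis.Theorems.GroundBartaEvenWinsBeyondArchDeflationWindowLoc2
import Summits.RiemannHypothesis.RiemannHypothesis.Theorems.GroundBartaEvenWinsBeyondArchDeflationWindowGlue
import Summits.RiemannHypothesis.RiemannHypothesis.Theorems.GroundBartaEvenWinsBeyondArchDeflationN83EAssembly
import Summits.RiemannHypothesis.RiemannHypothesis.Theorems.GroundBartaEvenWinsBeyondArchDeflationN83EAssemblyT1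
import Summits.RiemannHypothesis.RiemannHypothesis.Theorems.GroundBartaEvenWinsBeyondArchDeflationN83EAssemblyT2
import Summits.RiemannHypothesis.RiemannHypothesis.Theorems.GroundBartaEvenWinsBeyondArchDeflationN83EAssemblyT3
import Summits.RiemannHypothesis.RiemannHypothesis.Theorems.GroundBartaEvenWinsBeyondArchDeflationN83EAssemblyT4
import Summits.RiemannHypothesis.RiemannHypothesis.Theorems.GroundBartaEvenWinsBeyondArchDeflationN83EAssemblyT5
import Summits.RiemannHypothesis.RiemannHypothesis.Theorems.GroundBartaEvenWinsBeyondArchDeflationN83EAssemblyT6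
import Summits.RiemannHypothesis.RiemannHypothesis.Theorems.GroundBartaEvenWinsBeyondArchDeflationN83EAssemblyT7
import HarnessLib

/-!
# RiemannHypothesis / GroundBarta — rung 4 (`EvenWinsBeyondArch`, stmt-RiemannHypothesis-18807 / 18085), window `c = 83/100`:
# the deflated Temple L-side of the EVEN sector — window image and `λ ≤ ε_ev(83/100)` modulo three-zone R-layer data

Helper file (`--supports stmt-RiemannHypothesis-18085`), RH-free.  Prover A g12 (pattern of A g9's …M80PFinal, on the
`{2,3,4,5}`-window with the THREE-ZONE bridge `dt_weilEvenGroundEnergy_ge_of_deflCert_wxa45` and the phantom certificate C83X).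

Inputs: the even sector of the combined deflated phantom certificate C83X (`deflBound_even_weilCertDeflC83X`: `β₂₃ = 13/10`,
`a₀ = 83/100`, `N = 271`, nine even Ritz penalties `weilCertDeflC83XRE`), the A-layer of the SAME nine vectors `m83Ev`
(…N83EAssembly*: Markov-free entry bounds `m83ETAlo/hi`, Gram `m83EG`, `m83E_TA_mem`, `m83E_inner`, exact `LᵀDL` of `G`), and the
killing-constant bound `M ≤ m83EMhi` (width `3.6·10⁻²¹`, `dt_fp_weilMarkovConstant_sharp` via `m83_markov_mem`).

* `m83EF` — the window image of the nine even trial vectors at `c = c' = b = 83/100` (the bridge's `Fx_i`; `m83E_mask` identifies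
  `𝟙·maskPoly(r_i)` with `m83Ev i`, so the leak is `ν = 0`);
* `dt_n83E_evenLower_of_gramW3` — **`λ ≤ ε_ev(83/100)` modulo WEIGHTED three-zone R-layer data**: weighted residual norms
  `∫ w‖r_i‖² ≤ sW_i` and boxes for `∫ w Re(r_i r̄_j)`, with `w = 1/(13/10 − λ)` on `|y| < y₄`, `1/(13/10 − κ₄ − λ)` on `y₄ ≤ |y| < y₅`,
  `1/(13/10 − κ₄ − κ₅ − λ)` on `|y| ≥ y₅` (`κ₄ ≥ (log 2)/2`, `κ₅ ≥ log 5/√5`, `y₄ ≤ log 4 − 83/100`, `y₅ ≤ log 5 − 83/100`, `y₄ ≤ y₅`),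
  and a kernel certificate for `A − λG − R_w` (`nEntry` at `β' = λ + 1`).  With `λ = 0` this is the positivity-grade even block of
  `WeilPositivityOn (83/100)` (`weilPositivityOn_83_of_blocks`, p307654).
-/

set_option linter.dupNamespace false
set_option linter.unusedSimpArgs false

noncomputable section

open MeasureTheory Set
open scoped BigOperators ComplexConjugate

namespace Summit.RiemannHypothesis.RiemannHypothesis.Theorems.EvenWinsBeyondArch

open Literature.NumberTheory.LFunctions Literature.Analysis.ValidatedNumerics.ExpPoly
open Literature.Analysis.ValidatedNumerics.PolyMP
open Summit.RiemannHypothesis.RiemannHypothesis.Theorems.OddSector (weilDirichletEnergy₂ weilPoleForm₂)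

-- A g19 (2026-08-24) depth restage: the sector certificate bound below was the one-theorem module …WeilTwoPrimeDeflC83XCertE; it is proved HERE now
-- (declaration byte-identical, same namespace; that module is retired unfiled) so this Final no longer waits for a separate gate+build round.

/-- **Even sector**: for EVEN tests the bound holds with the even penalties `weilCertDeflC83XRE` alone (sector split). [folklore] -/
theorem deflBound_even_weilCertDeflC83X {g : ℝ → ℂ} (hg : IsWeilTest g)
    (hsupp : tsupport g ⊆ Set.Icc (-(83/100 : ℝ)) (83/100 : ℝ)) (heven : ∀ x, g (-x) = g x) :
    ((weilCertDeflC83XBeta : ℚ) : ℝ) * weilNorm2Sq g ≤ weilTwoPrimeQuadratic g +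
      (weilCertDeflC83XRE.map fun r ↦ (r.1 : ℝ) * ‖∑ k ∈ Finset.range (weilCertDeflC83X.base.N + 1),
        ((maskV r k : ℚ) : ℂ) * weilMoment weilCertDeflC83X.base.a0 g k‖ ^ 2).sum := by
  have hb : ((weilCertDeflC83X.b : ℚ) : ℝ) = (83/100 : ℝ) := by
    show (((83/100 : ℚ)) : ℝ) = _; norm_num
  have hsupp' : tsupport g ⊆ Set.Icc (-((weilCertDeflC83X.b : ℚ) : ℝ)) (weilCertDeflC83X.b : ℚ) := by rw [hb]; exact hsupp
  have h0 : weilCertDeflC83X.base.checkBlockP (fun k l ↦ weilCertDeflC83X.base.prQ weilCertDeflC83X.nuTab k l + rankOneQ weilCertDeflC83XR k l) (weilCertDeflC83X.kappaQ - weilCertDeflC83XBeta) 0 = true := by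
    rw [kappaQ_sub_beta_weilCertDeflC83X]; exact checkBlock0_weilCertDeflC83X
  exact dt_deflBound_even_of_append heven (weilCertDeflC83X.base.N + 1) (weilCertDeflC83X.base.a0 : ℝ) weilCertDeflC83XRE weilCertDeflC83XRO weilCertDeflC83XRO_odd
    (WeilCert23X.weilTwoPrimeQuadratic_rankOne_bound_even_of_parts (c := weilCertDeflC83X) (R := weilCertDeflC83XR) cellsOK_weilCertDeflC83X xOK_weilCertDeflC83X rip_weilCertDeflC83X
      checkScalars_weilCertDeflC83X checkNu_weilCertDeflC83X beta_le_kappaQ_weilCertDeflC83X h0 level_weilCertDeflC83X hg hsupp' heven)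

/-- The even penalty list of certificate C83X has nine entries. [folklore] -/
theorem m83E_Rlen : weilCertDeflC83XRE.length = 9 := rfl

set_option maxHeartbeats 0 in
/-- The certificate's masked coefficient vectors are the A-layer polynomials `P_i` padded with zeros. [folklore] -/
theorem m83E_trim : ∀ i : Fin weilCertDeflC83XRE.length, (List.range 272).map (maskV (weilCertDeflC83XRE.get i)) =
    m83EP i ++ List.replicate (272 - (m83EP i).length) 0 := by
  decide +kernel

/-- Even parities and non-negative weights of the penalties. [folklore] -/
theorem m83E_Reven : (∀ i : Fin weilCertDeflC83XRE.length, (weilCertDeflC83XRE.get i).2.1 % 2 = 0) ∧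
    (∀ i : Fin weilCertDeflC83XRE.length, 0 ≤ (weilCertDeflC83XRE.get i).1) := by
  constructor <;> decide

/-- **The bridge's penalty polynomials are the A-layer profiles**: `maskPoly(r_i, 272, 83/100) = g_i`. [folklore] -/
theorem m83E_mask (i : Fin weilCertDeflC83XRE.length) (x : ℝ) :
    maskPoly (weilCertDeflC83XRE.get i) 272 (83 / 100) x = m83Eg i x := by
  unfold m83Eg
  exact maskPoly_eq_poly_eval_of_trim _ _ (m83E_trim i) _ _

/-- **`TAlo_ij ≤ P₂ + 𝓔₂ ≤ TAhi_ij`** for all `i, j` (Markov-free A-layer bounds). [folklore] -/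
theorem m83E_TA_mem (i j : Fin 9) :
    ((m83ETAlo i j : ℚ) : ℝ) ≤ weilPoleForm₂ (m83Ev i) (m83Ev j) + weilDirichletEnergy₂ (((83 / 100 : ℚ)) : ℝ) (m83Ev i) (m83Ev j) ∧
      weilPoleForm₂ (m83Ev i) (m83Ev j) + weilDirichletEnergy₂ (((83 / 100 : ℚ)) : ℝ) (m83Ev i) (m83Ev j) ≤ ((m83ETAhi i j : ℚ) : ℝ) := by
  fin_cases i <;> fin_cases j
  exacts [m83E_TAmem_0_0, m83E_TAmem_0_1, m83E_TAmem_0_2, m83E_TAmem_0_3, m83E_TAmem_0_4, m83E_TAmem_0_5, m83E_TAmem_0_6, m83E_TAmem_0_7, m83E_TAmem_0_8, m83E_TAmem_1_0, m83E_TAmem_1_1, m83E_TAmem_1_2, m83E_TAmem_1_3, m83E_TAmem_1_4, m83E_TAmem_1_5, m83E_TAmem_1_6, m83E_TAmem_1_7, m83E_TAmem_1_8, m83E_TAmem_2_0, m83E_TAmem_2_1, m83E_TAmem_2_2, m83E_TAmem_2_3, m83E_TAmem_2_4, m83E_TAmem_2_5, m83E_TAmem_2_6, m83E_TAmem_2_7,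 m83E_TAmem_2_8, m83E_TAmem_3_0, m83E_TAmem_3_1, m83E_TAmem_3_2, m83E_TAmem_3_3, m83E_TAmem_3_4, m83E_TAmem_3_5, m83E_TAmem_3_6, m83E_TAmem_3_7, m83E_TAmem_3_8, m83E_TAmem_4_0, m83E_TAmem_4_1, m83E_TAmem_4_2, m83E_TAmem_4_3, m83E_TAmem_4_4, m83E_TAmem_4_5, m83E_TAmem_4_6, m83E_TAmem_4_7, m83E_TAmem_4_8, m83E_TAmem_5_0, m83E_TAmem_5_1, m83E_TAmem_5_2, m83E_TAmem_5_3, m83E_TAmem_5_4, m83E_TAmem_5_5, m83E_TAmem_5_6, m83E_TAmem_5_7, m83E_TAmem_5_8, m83E_TAmem_6_0, m83E_TAmem_6_1, m83E_TAmem_6_2, m83E_TAmem_6_3, m83E_TAmem_6_4, m83E_TAmem_6_5, m83E_TAmem_6_6, m83E_TAmem_6_7, m83E_TAmem_6_8, m83E_TAmem_7_0, m83E_TAmem_7_1, m83E_TAmem_7_2, m83E_TAmem_7_3, m83E_TAmem_7_4, m83E_TAmem_7_5, m83E_TAmem_7_6, m83E_TAmem_7_7, m83E_TAmem_7_8, m83E_TAmem_8_0,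 m83E_TAmem_8_1, m83E_TAmem_8_2, m83E_TAmem_8_3, m83E_TAmem_8_4, m83E_TAmem_8_5, m83E_TAmem_8_6, m83E_TAmem_8_7, m83E_TAmem_8_8]

/-- **`λ ≤ ε_ev(83/100)` modulo WEIGHTED three-zone R-layer data.**  `W` is the R-layer's coefficient matrix; `wI, wM, wE` the
three weight values (`wI = 1/(13/10 − λ)`, `wM = 1/(13/10 − κ₄ − λ)`, `wE = 1/(13/10 − κ₄ − κ₅ − λ)`, `κ₄ ≥ (log 2)/2`,
`κ₅ ≥ log 5/√5`), `y₄ ≤ log 4 − 83/100 ≤ y₅ ≤ log 5 − 83/100` the zone thresholds; `sW_i` bounds for `∫ w‖r_i‖²`,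
`[Rlo_ij, Rhi_ij]` (`i ≠ j`) boxes for `∫ w Re(r_i r̄_j)` (diagonal boxes `[sW_i, sW_i]`); `sc, P, E, D, L, δ` the scaled
kernel certificate of `A − λG − R_w` (`nEntry` at `β' = λ + 1`). [folklore] -/
theorem dt_n83E_evenLower_of_gramW3 (W : Fin 9 → Fin 9 → ℝ) (lam κ₄ κ₅ wI wM wE y₄ y₅ : ℚ)
    (hκ₄ : Real.log 2 / 2 ≤ (κ₄ : ℝ)) (hκ₅ : Real.log 5 / Real.sqrt 5 ≤ (κ₅ : ℝ))
    (hlam : lam + κ₄ + κ₅ < 13 / 10) (hwI : wI = 1 / (13 / 10 - lam)) (hwM : wM = 1 / (13 / 10 - κ₄ - lam))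
    (hwE : wE = 1 / (13 / 10 - κ₄ - κ₅ - lam))
    (hy₄ : (y₄ : ℝ) ≤ Real.log 4 - 83 / 100) (hy₅ : (y₅ : ℝ) ≤ Real.log 5 - 83 / 100) (hy45 : (y₄ : ℝ) ≤ (y₅ : ℝ))
    (sW : Fin 9 → ℚ)
    (hsW : ∀ i, ∫ y, m83Ew3 wI wM wE y₄ y₅ y * ‖(m83EF i - ∑ l, W i l • m83Ev l) y‖ ^ 2 ≤ (sW i : ℝ))
    (Rlo Rhi : Fin 9 → Fin 9 → ℚ) (hRdiag : ∀ i, Rlo i i = sW i ∧ Rhi i i = sW i)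
    (hR : ∀ i j, i ≠ j →
      (Rlo i j : ℝ) ≤ ∫ y, m83Ew3 wI wM wE y₄ y₅ y *
          ((m83EF i - ∑ l, W i l • m83Ev l) y * conj ((m83EF j - ∑ l, W j l • m83Ev l) y)).re ∧
        ∫ y, m83Ew3 wI wM wE y₄ y₅ y *
          ((m83EF i - ∑ l, W i l • m83Ev l) y * conj ((m83EF j - ∑ l, W j l • m83Ev l) y)).re ≤ (Rhi i j : ℝ))
    {m : ℕ} (sc : Fin 9 → ℚ) (hsc : ∀ i, 0 < sc i) (P E : Fin 9 → Fin 9 → ℚ)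
    (D : Fin m → ℚ) (L : Fin m → Fin 9 → ℚ) (δ : ℚ)
    (hPE : ∀ i j, ∀ a ∈ [m83ETAlo i j - m83EMhi * m83EG i j, m83ETAhi i j - m83EMhi * m83EG i j],
      P i j - E i j ≤ sc i * sc j * nEntry (lam + 1) lam (m83EG i j) (Rhi i j) a ∧
        sc i * sc j * nEntry (lam + 1) lam (m83EG i j) (Rlo i j) a ≤ P i j + E i j)
    (hrow : ∀ i, ∑ j, E i j ≤ δ) (hcol : ∀ j, ∑ i, E i j ≤ δ) (hD : ∀ r, 0 ≤ D r)
    (hP : ∀ i j, P i j = δ * (if i = j then 1 else 0) + ∑ r, D r * L r i * L r j) :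
    (lam : ℝ) ≤ weilEvenGroundEnergy (83 / 100 : ℝ) := by
  classical
  have hlog2 : Real.log 2 < (83 / 100 : ℝ) := by have := m83_log2_lt; push_cast at this; exact this
  have hc7 : (83 / 100 : ℝ) ≤ Real.log 7 / 2 := by have := m83_le_log7half; push_cast at this; exact this
  have hc5 : Real.log 5 / 2 < (83 / 100 : ℝ) := by have := m83_log5half_lt; push_cast at this; exact this
  have hlamQ : ((lam : ℚ) : ℝ) + (κ₄ : ℝ) + (κ₅ : ℝ) < 13 / 10 := by
    have h := (Rat.cast_lt (K := ℝ)).2 hlam; push_cast at h; exact h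
  have hlog0 : 0 < Real.log 2 / 2 := by positivity
  have hκ₄0 : (0 : ℝ) ≤ κ₄ := hlog0.le.trans hκ₄
  have hκ₅0 : (0 : ℝ) ≤ κ₅ := le_trans (by positivity) hκ₅
  have hnI : (0 : ℝ) < 13 / 10 - lam := by linarith
  have hnM : (0 : ℝ) < 13 / 10 - κ₄ - lam := by linarith
  have hnE : (0 : ℝ) < 13 / 10 - κ₄ - κ₅ - lam := by linarith
  have hwIR : (wI : ℝ) = 1 / (13 / 10 - 2 * (0 : ℝ) - (lam : ℝ)) := by rw [hwI]; push_cast; ring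
  have hwMR : (wM : ℝ) = 1 / (13 / 10 - 2 * (0 : ℝ) - (κ₄ : ℝ) - (lam : ℝ)) := by rw [hwM]; push_cast; ring
  have hwER : (wE : ℝ) = 1 / (13 / 10 - 2 * (0 : ℝ) - (κ₄ : ℝ) - (κ₅ : ℝ) - (lam : ℝ)) := by rw [hwE]; push_cast; ring
  -- the certificate's even sector, with literal parameters
  have hcert := fun (g : ℝ → ℂ) (hg : IsWeilTest g) (hsupp : tsupport g ⊆ Icc (-(83 / 100 : ℝ)) (83 / 100))
      (heven : ∀ x, g (-x) = g x) ↦ deflBound_even_weilCertDeflC83X hg hsupp heven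
  obtain ⟨hN1, ha0⟩ := params_weilCertDeflC83X
  have hβ23 : ((weilCertDeflC83XBeta : ℚ) : ℝ) = 13 / 10 := by show (((13 / 10 : ℚ)) : ℝ) = _; norm_num
  simp only [hN1, ha0, hβ23] at hcert
  have hM : weilMarkovConstant (83 / 100 : ℝ) ≤ ((m83EMhi : ℚ) : ℝ) := by
    have := m83_markov_mem.2; unfold m83EMhi; push_cast at this ⊢; exact this
  have hA := m83E_TA_mem
  have hG := m83E_inner
  -- the weight, the residuals and their weighted copies `r̃_i = √w · r_i`
  set w : ℝ → ℝ := m83Ew3 wI wM wE y₄ y₅ with hwdef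
  have hwcase : ∀ y, w y = (wE : ℝ) ∨ w y = (wM : ℝ) ∨ w y = (wI : ℝ) := by
    intro y
    by_cases h5 : y ∈ {u : ℝ | (y₅ : ℝ) ≤ |u|}
    · exact Or.inl (by rw [hwdef]; unfold m83Ew3; rw [Set.piecewise_eq_of_mem _ _ _ h5])
    · by_cases h4 : y ∈ {u : ℝ | (y₄ : ℝ) ≤ |u|}
      · exact Or.inr (Or.inl (by rw [hwdef]; unfold m83Ew3; rw [Set.piecewise_eq_of_notMem _ _ _ h5, Set.piecewise_eq_of_mem _ _ _ h4]))
      · exact Or.inr (Or.inr (by rw [hwdef]; unfold m83Ew3; rw [Set.piecewise_eq_of_notMem _ _ _ h5, Set.piecewise_eq_of_notMem _ _ _ h4]))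
  have hw0 : ∀ y, 0 ≤ w y := by
    intro y
    rcases hwcase y with h | h | h <;> rw [h]
    · rw [hwER]; exact le_of_lt (one_div_pos.2 (by linarith))
    · rw [hwMR]; exact le_of_lt (one_div_pos.2 (by linarith))
    · rw [hwIR]; exact le_of_lt (one_div_pos.2 (by linarith))
  set r : Fin 9 → ℝ → ℂ := fun i ↦ m83EF i - ∑ l, W i l • m83Ev l with hr
  set rt : Fin 9 → ℝ → ℂ := fun i y ↦ ((Real.sqrt (w y) : ℝ) : ℂ) * r i y with hrt
  have hrt_sq : ∀ i, ∫ y, ‖rt i y‖ ^ 2 = ∫ y, w y * ‖r i y‖ ^ 2 := fun i ↦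
    integral_congr_ae (Filter.Eventually.of_forall fun y ↦ dt_norm_sq_sqrt_mul (hw0 y) _)
  have hrt_cross : ∀ i j, ∫ y, (rt i y * conj (rt j y)).re = ∫ y, w y * (r i y * conj (r j y)).re := fun i j ↦
    integral_congr_ae (Filter.Eventually.of_forall fun y ↦ dt_sqrt_mul_pairing_pt hw0 (r i) (r j) y)
  -- the matrix `R'_w` (certified diagonal bounds, true weighted cross terms) and its boxes
  set Rm : Fin 9 → Fin 9 → ℝ := fun i j ↦ if i = j then ((sW i : ℚ) : ℝ) else ∫ y, (rt i y * conj (rt j y)).re with hRm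
  have hRbox : ∀ i j, (Rlo i j : ℝ) ≤ Rm i j ∧ Rm i j ≤ (Rhi i j : ℝ) := by
    intro i j
    by_cases hij : i = j
    · subst hij
      obtain ⟨h1, h2⟩ := hRdiag i
      simp only [hRm, if_true, h1, h2]; exact ⟨le_rfl, le_rfl⟩
    · simp only [hRm, if_neg hij, hrt_cross, hr, hwdef]
      exact hR i j hij
  -- kernel certificate ⇒ `(A − λG) − R'_w ⪰ 0` (β' = λ + 1)
  have hPE' : ∀ i j, ∀ β' ∈ [lam + 1, lam + 1], ∀ a ∈ [m83ETAlo i j - m83EMhi * m83EG i j, m83ETAhi i j - m83EMhi * m83EG i j],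
      P i j - E i j ≤ sc i * sc j * nEntry β' lam (m83EG i j) (Rhi i j) a ∧
        sc i * sc j * nEntry β' lam (m83EG i j) (Rlo i j) a ≤ P i j + E i j := by
    intro i j β' hβ' a ha
    have : β' = lam + 1 := by simpa using hβ'
    subst this
    exact hPE i j a ha
  have hN := dt_hN_of_boundsT₃
    (fun i j ↦ weilPoleForm₂ (m83Ev i) (m83Ev j) + weilDirichletEnergy₂ (((83 / 100 : ℚ)) : ℝ) (m83Ev i) (m83Ev j))
    m83ETAlo m83ETAhi m83EG hA (fun i j ↦ ∫ x, (m83Ev i x * conj (m83Ev j x)).re) hG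
    (M := weilMarkovConstant (83 / 100 : ℝ)) m83EMhi hM m83EGD m83EGL m83E_G_ldl.1 m83E_G_ldl.2
    (β := (lam : ℝ) + 1) (lam + 1) (lam + 1) (by push_cast; exact ⟨le_rfl, le_rfl⟩) Rm Rlo Rhi hRbox lam (by linarith)
    sc hsc P E D L δ hPE' hrow hcol hD hP
  have h83 : (((83 / 100 : ℚ)) : ℝ) = (83 / 100 : ℝ) := by norm_num
  simp only [h83, add_sub_cancel_left, one_mul] at hN
  -- cross-Gram criterion on the weighted residuals ⇒ the bridge's weighted `hPSD`
  have hsR : ∀ i, ∫ y, ‖rt i y‖ ^ 2 ≤ ((sW i : ℚ) : ℝ) := fun i ↦ by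
    rw [hrt_sq]; simpa only [hr, hwdef] using hsW i
  have hPSD := dt_psd_of_crossGram
    (fun i j ↦ (weilPoleForm₂ (m83Ev i) (m83Ev j) + weilDirichletEnergy₂ (83 / 100 : ℝ) (m83Ev i) (m83Ev j) -
          weilMarkovConstant (83 / 100 : ℝ) * ∫ x, (m83Ev i x * conj (m83Ev j x)).re) -
        (lam : ℝ) * ∫ x, (m83Ev i x * conj (m83Ev j x)).re)
    rt (fun i ↦ ((sW i : ℚ) : ℝ)) hsR (fun α ↦ by simpa only [hRm] using hN α)
  -- the weight in the bridge's form
  have hwform : ∀ y, w y = ({u : ℝ | (y₅ : ℝ) ≤ |u|}.piecewise (fun _ ↦ 1 / (13 / 10 - 2 * (0 : ℝ) - (κ₄ : ℝ) - (κ₅ : ℝ) - (lam : ℝ)))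
          ({u : ℝ | (y₄ : ℝ) ≤ |u|}.piecewise (fun _ ↦ 1 / (13 / 10 - 2 * (0 : ℝ) - (κ₄ : ℝ) - (lam : ℝ)))
            (fun _ ↦ 1 / (13 / 10 - 2 * (0 : ℝ) - (lam : ℝ))))) y := by
    intro y
    rw [hwdef]; unfold m83Ew3
    by_cases h5 : y ∈ {u : ℝ | (y₅ : ℝ) ≤ |u|}
    · rw [Set.piecewise_eq_of_mem _ _ _ h5, Set.piecewise_eq_of_mem _ _ _ h5, hwER]
    · rw [Set.piecewise_eq_of_notMem _ _ _ h5, Set.piecewise_eq_of_notMem _ _ _ h5]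
      by_cases h4 : y ∈ {u : ℝ | (y₄ : ℝ) ≤ |u|}
      · rw [Set.piecewise_eq_of_mem _ _ _ h4, Set.piecewise_eq_of_mem _ _ _ h4, hwMR]
      · rw [Set.piecewise_eq_of_notMem _ _ _ h4, Set.piecewise_eq_of_notMem _ _ _ h4, hwIR]
  have hPSD' : ∀ α : Fin 9 → ℝ, 0 ≤ ∑ i, ∑ j, α i * α j *
      ((weilPoleForm₂ (m83Ev i) (m83Ev j) + weilDirichletEnergy₂ (83 / 100 : ℝ) (m83Ev i) (m83Ev j) -
          weilMarkovConstant (83 / 100 : ℝ) * ∫ x, (m83Ev i x * conj (m83Ev j x)).re) -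
        (lam : ℝ) * (∫ x, (m83Ev i x * conj (m83Ev j x)).re) -
        ∫ y, ({u : ℝ | (y₅ : ℝ) ≤ |u|}.piecewise (fun _ ↦ 1 / (13 / 10 - 2 * (0 : ℝ) - (κ₄ : ℝ) - (κ₅ : ℝ) - (lam : ℝ)))
          ({u : ℝ | (y₄ : ℝ) ≤ |u|}.piecewise (fun _ ↦ 1 / (13 / 10 - 2 * (0 : ℝ) - (κ₄ : ℝ) - (lam : ℝ)))
            (fun _ ↦ 1 / (13 / 10 - 2 * (0 : ℝ) - (lam : ℝ))))) y *
          ((m83EF i - ∑ l, W i l • m83Ev l) y * conj ((m83EF j - ∑ l, W j l • m83Ev l) y)).re) := by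
    intro α
    have h := hPSD α
    have e : ∀ i j, ∫ y, (rt i y * conj (rt j y)).re =
        ∫ y, ({u : ℝ | (y₅ : ℝ) ≤ |u|}.piecewise (fun _ ↦ 1 / (13 / 10 - 2 * (0 : ℝ) - (κ₄ : ℝ) - (κ₅ : ℝ) - (lam : ℝ)))
          ({u : ℝ | (y₄ : ℝ) ≤ |u|}.piecewise (fun _ ↦ 1 / (13 / 10 - 2 * (0 : ℝ) - (κ₄ : ℝ) - (lam : ℝ)))
            (fun _ ↦ 1 / (13 / 10 - 2 * (0 : ℝ) - (lam : ℝ))))) y *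
          ((m83EF i - ∑ l, W i l • m83Ev l) y * conj ((m83EF j - ∑ l, W j l • m83Ev l) y)).re := by
      intro i j
      rw [hrt_cross]
      exact integral_congr_ae (Filter.Eventually.of_forall fun y ↦ by simp only [hr, hwform y])
    simpa only [e] using h
  -- the leak vanishes: the penalties ARE the profiles (ν = 0) and `a₀ = c'`
  have hν : ∑ i : Fin weilCertDeflC83XRE.length, ((weilCertDeflC83XRE.get i).1 : ℝ) *
      ((∫ x in Icc (-(83 / 100 : ℝ)) (83 / 100),
          (maskPoly (weilCertDeflC83XRE.get i) 272 (83 / 100) x - m83Eg i x) ^ 2) +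
        ∫ x in Icc (-(83 / 100 : ℝ)) (83 / 100) \ Icc (-(83 / 100 : ℝ)) (83 / 100),
          (maskPoly (weilCertDeflC83XRE.get i) 272 (83 / 100) x) ^ 2) ≤ (0 : ℝ) := by
    refine le_of_eq (Finset.sum_eq_zero fun i _ ↦ ?_)
    have h1 : (fun x ↦ (maskPoly (weilCertDeflC83XRE.get i) 272 (83 / 100) x - m83Eg i x) ^ 2) =
        fun _ ↦ (0 : ℝ) := by
      funext x
      rw [m83E_mask i x]; ring
    rw [h1, Set.sdiff_self]
    simp
  exact dt_weilEvenGroundEnergy_ge_of_deflCert_wxa45 (c := 83 / 100) (c' := 83 / 100) (b := 83 / 100) (a₀ := 83 / 100)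
    hlog2 le_rfl hc7 le_rfl le_rfl rfl rfl (fun _ _ ↦ rfl) weilCertDeflC83XRE 272
    m83Eg m83Eg_contDiff m83Eg_even m83E_Reven.2 hcert m83Ev m83EF m83Ev_eq (fun i y ↦ rfl) W hκ₄ hκ₅ hν
    (by linarith) hy₄ hy₅ hy45 hPSD'

end Summit.RiemannHypothesis.RiemannHypothesis.Theorems.EvenWinsBeyondArch

end
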